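import Summits.BirchSwinnertonDyer.BirchSwinnertonDyer.Theorems.ClassRecordThreeEulerHalvesAtThreeKolyvaginFamilyDataDefs
import Summits.BirchSwinnertonDyer.Rank1Residual.X11b.Three.KolyvaginLine
import HarnessLib

/-!
# (P0′) of RULING 46, second file — McCallum's `p^M ∣ P_n` and `ord_p(P_n)` for the GENERALISED Kolyvagin datum
# `JET.KolyvaginFamilyData W K ι n` (twins of `X11b.Three.Koly.PDiv` ∕ `Koly.divOrd`, which are typed on the `X₀(N)` datum
# `KolyvaginHeegnerData Dt β ι n`), with the `rfl` dictionary along `toFamilyData` and the order bookkeeping the walk's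
# combinator uses (cell `bsd-stepL`, seat `bsd-stepL-tam3-p1` g12, owner of 19109's line; `--supports stmt-BirchSwinnertonDyer-19109 --as helper`)

WHY. The Shimura-walk port (PORT MAP (P2); RULING 46 «generalise the datum, additively and on demand») needs the currency of
`stub_jetchevMaxHLAtThree` ∕ of the (DIV) conjunct — `PDiv d p M` («`P_n ∈ p^M E(K[n])`») and `divOrd d p` («`ord_p(P_n)`»,
McCallum 1991 §5) — on data that carry no modular parametrisation. TWO definitions VERBATIM those of
`Summits/BirchSwinnertonDyer/Rank1Residual/X11b/Three/KolyvaginLine.lean` (:98, :107) with the datum type replaced, the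
dictionary `pDiv_toFamilyData` ∕ `divOrd_toFamilyData` (`Iff.rfl` ∕ `rfl`: `toFamilyData_derivedPoint` is `rfl`), and the six
bookkeeping lemmas of `KolyvaginLine` §2 ∕ `…Section6Bridge` ∕ `…KolyJRedefinition` §1 (`pDiv_zero`, `pDiv_mono`,
`divOrd_eq_findGreatest_of_not_pDiv`, `divOrd_le_of_not_pDiv`, `pDiv_of_le_divOrd`, `natCast_le_divOrd_of_pDiv`), proofs
VERBATIM. The walk combinator over these (`pDiv_of_perLevel`, Kolyvagin's redefinition from the swap, `pDiv_of_swap_of_perLevel`)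
follows in `…KolyvaginFamilyWalkCombinator.lean`.

HONEST FRAMING: TWO definitions + bookkeeping theorems; no named fact, no instance, no notation, no `sorry`; nothing about any
curve is asserted; no item closes; BSD is not proved by any of this. Additive (nothing landed is edited).
References: [cite: McCallumLMS1991, §5 (p. 303) `p^M | P_n`, `ord_p(P_n)`, Lemma 5.1, Prop. 5.2] [cite: GrossLMS1991, §4 (4.1)]
[cite: Jetchev2008, Thm. 1.4 (p. 812)].
presearch: not applicable (interface twins of tree definitions); `lean search 'KolyvaginFamilyData.PDiv|Family.*divOrd'` → none.
-/

set_option autoImplicit false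

noncomputable section

open scoped Classical

universe u

namespace Summit.BirchSwinnertonDyer.Rank1Residual.JET

open WeierstrassCurve NumberField Literature.NumberTheory.EllipticCurves

namespace KolyvaginFamilyData

variable {W : WeierstrassCurve ℚ} {K : Type u} [Field K] [NumberField K] {ι : K →+* ℂ} {n : ℕ}
  (d : KolyvaginFamilyData W K ι n) (p : ℕ)

/-! ### §1 The two invariants -/

/-- **`p^M | P_n`** (McCallum p. 303: «`P_n ∈ p^M E(K_n)`») for the derived point `P_n = d.derivedPoint ∈ E(K[n])` of a
family datum `d` of conductor `n`; twin of `X11b.Three.Koly.PDiv`. [cite: McCallumLMS1991, §5 (p. 303), `p^M | P_n`] -/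
def PDiv (M : ℕ) : Prop :=
  ∃ Q : (W.baseChange (ringClassField K ι n)).toAffine.Point, ((p ^ M : ℕ) : ℤ) • Q = d.derivedPoint

/-- **`ord_p(P_n) = max{M : p^M | P_n}`** in `ℕ∞` (`⊤` when `P_n` is `p^M`-divisible for every `M`); twin of
`X11b.Three.Koly.divOrd`. [cite: McCallumLMS1991, §5 (p. 303), `ord_p(P_n)`] -/
def divOrd : ℕ∞ :=
  ⨆ (M : ℕ) (_ : d.PDiv p M), (M : ℕ∞)

/-! ### §2 Bookkeeping (proofs verbatim from `KolyvaginLine` §2, `…Section6Bridge`, `…KolyJRedefinition` §1) -/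

/-- `p^0 | P_n`. [folklore] -/
theorem pDiv_zero : d.PDiv p 0 := ⟨d.derivedPoint, by simp⟩

/-- `p^M | P_n` is downward closed in `M`. [folklore] -/
theorem pDiv_mono {M M' : ℕ} (h : M ≤ M') (hM' : d.PDiv p M') : d.PDiv p M := by
  obtain ⟨Q, hQ⟩ := hM'
  refine ⟨((p ^ (M' - M) : ℕ) : ℤ) • Q, ?_⟩
  rw [smul_smul, ← Nat.cast_mul, ← pow_add, Nat.add_sub_cancel' h, hQ]

/-- If `p^{M+1} ∤ P_n` then `ord_p(P_n) = Nat.findGreatest (PDiv d p) M`. [folklore] -/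
theorem divOrd_eq_findGreatest_of_not_pDiv {M : ℕ} (hM : ¬ d.PDiv p (M + 1)) :
    d.divOrd p = (Nat.findGreatest (d.PDiv p) M : ℕ) := by
  have hle : ∀ M', d.PDiv p M' → M' ≤ M := fun M' hM' ↦ by
    by_contra hlt
    exact hM (d.pDiv_mono p (by omega) hM')
  apply le_antisymm
  · refine iSup₂_le fun M' hM' ↦ ?_
    exact_mod_cast Nat.le_findGreatest (hle M' hM') hM'
  · exact le_iSup₂ (f := fun (M' : ℕ) (_ : d.PDiv p M') ↦ (M' : ℕ∞)) (Nat.findGreatest (d.PDiv p) M)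
      (Nat.findGreatest_spec (P := d.PDiv p) (Nat.zero_le M) (d.pDiv_zero p))

/-- A certificate `p^{M+1} ∤ P_n` gives `ord_p(P_n) ≤ M`. [folklore] -/
theorem divOrd_le_of_not_pDiv {M : ℕ} (hM : ¬ d.PDiv p (M + 1)) : d.divOrd p ≤ M := by
  rw [d.divOrd_eq_findGreatest_of_not_pDiv p hM]
  exact_mod_cast Nat.findGreatest_le M

/-- `ord_p(P_n) ≥ s` in `ℕ∞` means `p^s | P_n`. [cite: McCallumLMS1991, §5 (p. 303)] -/
theorem pDiv_of_le_divOrd (s : ℕ) (h : (s : ℕ∞) ≤ d.divOrd p) : d.PDiv p s := by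
  by_contra hs
  rcases Nat.eq_zero_or_pos s with rfl | hpos
  · exact hs (d.pDiv_zero p)
  · obtain ⟨s', rfl⟩ : ∃ s', s = s' + 1 := ⟨s - 1, by omega⟩
    have h' : d.divOrd p ≤ (s' : ℕ∞) := d.divOrd_le_of_not_pDiv p hs
    have : ((s' + 1 : ℕ) : ℕ∞) ≤ (s' : ℕ∞) := h.trans h'
    have : s' + 1 ≤ s' := by exact_mod_cast this
    omega

/-- `p^M | P_n` gives `M ≤ ord_p(P_n)`. [cite: McCallumLMS1991, §5 (p. 303)] -/
theorem natCast_le_divOrd_of_pDiv {M : ℕ} (h : d.PDiv p M) : (M : ℕ∞) ≤ d.divOrd p :=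
  le_iSup₂_of_le (f := fun (M : ℕ) (_ : d.PDiv p M) => (M : ℕ∞)) M h le_rfl

end KolyvaginFamilyData

/-! ### §3 Dictionary along `toFamilyData` -/

namespace KolyvaginHeegnerDataToFamily

variable {N : ℕ} [NeZero N] {W : WeierstrassCurve ℚ} {K : Type u} [Field K] [NumberField K]
  {Dt : ModularForms.ModularParametrizationData W N} {β : ℤ} {ι : K →+* ℂ} {n : ℕ}
  (d : KolyvaginHeegnerData Dt β ι n) (p : ℕ)

/-- Dictionary: `p^M | P_n` for the forgetful image is the `X₀(N)` datum's `Koly.PDiv`. [folklore] -/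
theorem pDiv_toFamilyData (M : ℕ) : d.toFamilyData.PDiv p M ↔ X11b.Three.Koly.PDiv d p M := Iff.rfl

/-- Dictionary: `ord_p(P_n)` for the forgetful image is the `X₀(N)` datum's `Koly.divOrd`. [folklore] -/
theorem divOrd_toFamilyData : d.toFamilyData.divOrd p = X11b.Three.Koly.divOrd d p := rfl

end KolyvaginHeegnerDataToFamily

end Summit.BirchSwinnertonDyer.Rank1Residual.JET

end
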